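import Summits.NavierStokesRegularity.FunctionalMining.TopEigDanskin
import HarnessLib

/-!
# FunctionalMining — simple top eigenvectors in Rayleigh form; convex combinations keep a common strict top vector

Search for candidate a priori estimates; no regularity claim. Cell `pub-nsfunc`, prove seat
(gen 21). Kernel form of the no-go seat's kernel candidate K-d (`NoGo/STAGING.md`; the algebraic
core of F1 PART I ADDENDUM 1, Lemma 6′ step (1), pen, countersigned in the cell — not a cited fact):

> if `J c = 0` and `c` is a strict top eigenvector of `S⁻` and of `S⁺ = S⁻ + J` with margin `μ`, then
> `c` is the simple top eigenvector of `S⁻ + θJ` for every `θ ∈ [0, 1]`, with gap `≥ μ`.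

Everything is stated for the top Rayleigh value `λ(A) = sup_{eᵀe = 1} eᵀAe` of `TopEigRayleigh.lean`
and the top eigen-set / directional value of `TopEigDanskin.lean`, in the GAP FORM

  `(G)   eᵀAe ≤ λ₀ − μ (1 − (e·c)²)` for every unit `e`, and `cᵀAc = λ₀`,

which for a symmetric matrix says exactly: `c` is a unit eigenvector with eigenvalue `λ₀ = λ₁` and all
Rayleigh values on `c^⊥` are `≤ λ₀ − μ` (`TopEig.gapForm_of_eigenvector`, the bridge from
`M c = λ₀ c` + the Rayleigh bound on `c^⊥`).

* `TopEig.lam_eq_of_gapForm`, `TopEig.topEigSet_eq_pair_of_gapForm` — under (G) with `μ > 0`: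
  `λ(A) = λ₀` and the top eigen-set is `{c, −c}` (a SIMPLE top eigenvector);
* `TopEig.dirTopEig_eq_quad_of_topEigSet_eq_pair` — then `μ(A; M) = cᵀMc` for every direction `M`
  (the Danskin derivative is the plain first-order perturbation formula);
* **`TopEig.gapForm_segment`** (K-d) — (G) for `A` and for `B` with the same `(c, λ₀, μ)` gives (G) for
  every point `A + θ(B − A)`, `θ ∈ [0,1]`, of the segment; hence `λ = λ₀`, top eigen-set `{±c}`, and
  `μ(A + θ(B − A); M) = cᵀMc` along the whole segment (`TopEig.simpleTop_segment`);
* `TopEig.gapForm_of_eigenvector` — the matrix reading of (G).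

Elementary and dimension-free. [ours; folklore linear algebra]
-/

noncomputable section

open Set
open scoped Matrix

namespace Summit.NavierStokesRegularity.FunctionalMining

namespace TopEig

variable {d : Type*} [Fintype d] [DecidableEq d] [Nonempty d]

/-! ## 1. Unit vectors: evenness of the Rayleigh form, the aligned case of Cauchy–Schwarz -/

omit [DecidableEq d] [Nonempty d] in
/-- The Rayleigh form is even in the vector: `(−e)ᵀA(−e) = eᵀAe`. [folklore] -/
theorem quad_neg_vec (A : EuclideanSpace ℝ (d × d)) (e : d → ℝ) : quad A (-e) = quad A e := by
  simp only [quad, Pi.neg_apply]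
  exact Finset.sum_congr rfl fun i _ => Finset.sum_congr rfl fun j _ => by ring

omit [DecidableEq d] [Nonempty d] in
/-- `−e` is a unit vector when `e` is. [folklore] -/
theorem neg_mem_unitSphere {e : d → ℝ} (he : e ∈ unitSphere d) : -e ∈ unitSphere d := by
  show (-e) ⬝ᵥ (-e) = 1
  rw [neg_dotProduct, dotProduct_neg, neg_neg]
  exact he

omit [DecidableEq d] [Nonempty d] in
/-- The top eigen-set is symmetric under `e ↦ −e`. [folklore] -/
theorem neg_mem_topEigSet {A : EuclideanSpace ℝ (d × d)} {e : d → ℝ} (he : e ∈ topEigSet A) :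
    -e ∈ topEigSet A :=
  ⟨neg_mem_unitSphere he.1, by rw [quad_neg_vec]; exact he.2⟩

omit [DecidableEq d] [Nonempty d] in
/-- `∑ᵢ (eᵢ − a cᵢ)² = eᵀe − 2a eᵀc + a² cᵀc`. [folklore] -/
theorem sum_sq_sub_mul_eq (e c : d → ℝ) (a : ℝ) :
    ∑ i, (e i - a * c i) ^ 2 = e ⬝ᵥ e - 2 * a * (e ⬝ᵥ c) + a ^ 2 * (c ⬝ᵥ c) := by
  have h : ∀ i, (e i - a * c i) ^ 2 = e i * e i - 2 * a * (e i * c i) + a ^ 2 * (c i * c i) :=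
    fun i => by ring
  simp only [h, Finset.sum_add_distrib, Finset.sum_sub_distrib, ← Finset.mul_sum, dotProduct]

omit [DecidableEq d] [Nonempty d] in
/-- For unit `e, c`: `∑ᵢ (eᵢ − (e·c) cᵢ)² = 1 − (e·c)²` (the defect in Cauchy–Schwarz). [folklore] -/
theorem sum_sq_sub_proj_eq {e c : d → ℝ} (he : e ∈ unitSphere d) (hc : c ∈ unitSphere d) :
    ∑ i, (e i - (e ⬝ᵥ c) * c i) ^ 2 = 1 - (e ⬝ᵥ c) ^ 2 := by
  rw [sum_sq_sub_mul_eq, show e ⬝ᵥ e = 1 from he, show c ⬝ᵥ c = 1 from hc]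
  ring

omit [DecidableEq d] [Nonempty d] in
/-- Cauchy–Schwarz for unit vectors: `(e·c)² ≤ 1`. [folklore] -/
theorem dotProduct_sq_le_one {e c : d → ℝ} (he : e ∈ unitSphere d) (hc : c ∈ unitSphere d) :
    (e ⬝ᵥ c) ^ 2 ≤ 1 := by
  have h := sum_sq_sub_proj_eq he hc
  have h0 : 0 ≤ ∑ i, (e i - (e ⬝ᵥ c) * c i) ^ 2 := Finset.sum_nonneg fun i _ => sq_nonneg _
  linarith

omit [DecidableEq d] [Nonempty d] in
/-- The aligned case: unit vectors with `(e·c)² = 1` are `e = c` or `e = −c`. [folklore] -/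
theorem eq_or_eq_neg_of_dotProduct_sq_eq_one {e c : d → ℝ} (he : e ∈ unitSphere d)
    (hc : c ∈ unitSphere d) (h : (e ⬝ᵥ c) ^ 2 = 1) : e = c ∨ e = -c := by
  have hzero : ∀ i, e i - (e ⬝ᵥ c) * c i = 0 := by
    have h0 : ∑ i, (e i - (e ⬝ᵥ c) * c i) ^ 2 = 0 := by rw [sum_sq_sub_proj_eq he hc, h, sub_self]
    intro i
    have h1 := (Finset.sum_eq_zero_iff_of_nonneg fun j _ => sq_nonneg (e j - (e ⬝ᵥ c) * c j)).1 h0 i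
      (Finset.mem_univ i)
    exact pow_eq_zero_iff two_ne_zero |>.1 h1
  have ha : e ⬝ᵥ c = 1 ∨ e ⬝ᵥ c = -1 := mul_self_eq_one_iff.1 (by rw [← sq]; exact h)
  rcases ha with ha | ha
  · left
    funext i
    have h1 := hzero i
    rw [ha, one_mul] at h1
    linarith
  · right
    funext i
    have h1 := hzero i
    rw [ha, Pi.neg_apply] at *
    linarith

/-! ## 2. The gap form `eᵀAe ≤ λ₀ − μ(1 − (e·c)²)`: simple top eigenvector, `λ = λ₀`, `μ(A; M) = cᵀMc` -/

/-- Under the gap form with `μ ≥ 0` and `cᵀAc = λ₀`: `λ(A) = λ₀`. [folklore] -/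
theorem lam_eq_of_gapForm {A : EuclideanSpace ℝ (d × d)} {c : d → ℝ} {lam0 μ : ℝ}
    (hc : c ∈ unitSphere d) (hμ : 0 ≤ μ)
    (hgap : ∀ e ∈ unitSphere d, quad A e ≤ lam0 - μ * (1 - (e ⬝ᵥ c) ^ 2)) (hAc : quad A c = lam0) :
    lam A = lam0 := by
  refine le_antisymm (lam_le fun e he => (hgap e he).trans ?_) (hAc ▸ quad_le_lam A hc)
  have h1 := dotProduct_sq_le_one he hc
  nlinarith

/-- Under the gap form, `c` is a top vector. [folklore] -/
theorem mem_topEigSet_of_gapForm {A : EuclideanSpace ℝ (d × d)} {c : d → ℝ} {lam0 μ : ℝ}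
    (hc : c ∈ unitSphere d) (hμ : 0 ≤ μ)
    (hgap : ∀ e ∈ unitSphere d, quad A e ≤ lam0 - μ * (1 - (e ⬝ᵥ c) ^ 2)) (hAc : quad A c = lam0) :
    c ∈ topEigSet A :=
  ⟨hc, by rw [hAc, lam_eq_of_gapForm hc hμ hgap hAc]⟩

/-- **Under the gap form with `μ > 0` the top eigenvector is simple: the top eigen-set is `{c, −c}`.**
[folklore] -/
theorem topEigSet_eq_pair_of_gapForm {A : EuclideanSpace ℝ (d × d)} {c : d → ℝ} {lam0 μ : ℝ}
    (hc : c ∈ unitSphere d) (hμ : 0 < μ)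
    (hgap : ∀ e ∈ unitSphere d, quad A e ≤ lam0 - μ * (1 - (e ⬝ᵥ c) ^ 2)) (hAc : quad A c = lam0) :
    topEigSet A = {c, -c} := by
  have hlam := lam_eq_of_gapForm hc hμ.le hgap hAc
  ext e
  simp only [mem_insert_iff, mem_singleton_iff]
  constructor
  · intro he
    have h1 := hgap e he.1
    rw [he.2, hlam] at h1
    have h2 := dotProduct_sq_le_one he.1 hc
    have hsq : (e ⬝ᵥ c) ^ 2 = 1 := by nlinarith
    exact eq_or_eq_neg_of_dotProduct_sq_eq_one he.1 hc hsq
  · rintro (rfl | rfl)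
    · exact mem_topEigSet_of_gapForm hc hμ.le hgap hAc
    · exact neg_mem_topEigSet (mem_topEigSet_of_gapForm hc hμ.le hgap hAc)

omit [DecidableEq d] [Nonempty d] in
/-- **For a simple top eigenvector, `μ(A; M) = cᵀMc`** for every direction `M`: the Danskin derivative
`(d/dτ)|_{0⁺} λ(A + τM)` is the first-order perturbation formula. [folklore] -/
theorem dirTopEig_eq_quad_of_topEigSet_eq_pair {A M : EuclideanSpace ℝ (d × d)} {c : d → ℝ}
    (h : topEigSet A = {c, -c}) : dirTopEig A M = quad M c := by
  rw [dirTopEig, h, image_pair, quad_neg_vec, pair_eq_singleton, csSup_singleton]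

/-- Under the gap form with `μ > 0`: `μ(A; M) = cᵀMc` for every `M`. [folklore] -/
theorem dirTopEig_eq_quad_of_gapForm {A : EuclideanSpace ℝ (d × d)} {c : d → ℝ} {lam0 μ : ℝ}
    (hc : c ∈ unitSphere d) (hμ : 0 < μ)
    (hgap : ∀ e ∈ unitSphere d, quad A e ≤ lam0 - μ * (1 - (e ⬝ᵥ c) ^ 2)) (hAc : quad A c = lam0)
    (M : EuclideanSpace ℝ (d × d)) : dirTopEig A M = quad M c :=
  dirTopEig_eq_quad_of_topEigSet_eq_pair (topEigSet_eq_pair_of_gapForm hc hμ hgap hAc)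

omit [DecidableEq d] [Nonempty d] in
/-- The gap form gives the Rayleigh bound `eᵀAe ≤ λ₀ − μ` on `c^⊥`. [folklore] -/
theorem quad_le_of_gapForm_of_perp {A : EuclideanSpace ℝ (d × d)} {c : d → ℝ} {lam0 μ : ℝ}
    (hgap : ∀ e ∈ unitSphere d, quad A e ≤ lam0 - μ * (1 - (e ⬝ᵥ c) ^ 2)) {e : d → ℝ}
    (he : e ∈ unitSphere d) (hperp : e ⬝ᵥ c = 0) : quad A e ≤ lam0 - μ := by
  have h := hgap e he
  rw [hperp] at h
  simpa using h

/-! ## 3. K-d: convex combinations keep a common strict top vector -/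

omit [DecidableEq d] [Nonempty d] in
/-- **Lemma 6′ algebraic core (kernel candidate K-d), gap form.** If `A` and `B` both satisfy the gap
form with the same unit vector `c`, level `λ₀` and margin `μ` (`cᵀAc = cᵀBc = λ₀`,
`eᵀAe, eᵀBe ≤ λ₀ − μ(1 − (e·c)²)` for unit `e`), then so does every point `A + θ(B − A)`, `θ ∈ [0,1]`,
of the segment. [folklore; F1 PART I ADD1 Lemma 6′ step (1)] -/
theorem gapForm_segment {A B : EuclideanSpace ℝ (d × d)} {c : d → ℝ} {lam0 μ θ : ℝ}
    (hθ0 : 0 ≤ θ) (hθ1 : θ ≤ 1)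
    (hA : ∀ e ∈ unitSphere d, quad A e ≤ lam0 - μ * (1 - (e ⬝ᵥ c) ^ 2)) (hAc : quad A c = lam0)
    (hB : ∀ e ∈ unitSphere d, quad B e ≤ lam0 - μ * (1 - (e ⬝ᵥ c) ^ 2)) (hBc : quad B c = lam0) :
    (∀ e ∈ unitSphere d, quad (A + θ • (B - A)) e ≤ lam0 - μ * (1 - (e ⬝ᵥ c) ^ 2)) ∧
      quad (A + θ • (B - A)) c = lam0 := by
  refine ⟨fun e he => ?_, ?_⟩
  · rw [quad_add, quad_smul, quad_sub]
    have h1 := hA e he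
    have h2 := hB e he
    nlinarith
  · rw [quad_add, quad_smul, quad_sub, hAc, hBc]
    ring

/-- **K-d, conclusions along the segment**: with `μ > 0`, at every `A + θ(B − A)`, `θ ∈ [0,1]`:
`λ = λ₀`, the top eigen-set is `{c, −c}` (simple top eigenvector `c`, gap `≥ μ` on `c^⊥`), and
`μ(A + θ(B − A); M) = cᵀMc` for every direction `M`. [folklore; F1 PART I ADD1 Lemma 6′ step (1)] -/
theorem simpleTop_segment {A B : EuclideanSpace ℝ (d × d)} {c : d → ℝ} {lam0 μ θ : ℝ}
    (hc : c ∈ unitSphere d) (hμ : 0 < μ) (hθ0 : 0 ≤ θ) (hθ1 : θ ≤ 1)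
    (hA : ∀ e ∈ unitSphere d, quad A e ≤ lam0 - μ * (1 - (e ⬝ᵥ c) ^ 2)) (hAc : quad A c = lam0)
    (hB : ∀ e ∈ unitSphere d, quad B e ≤ lam0 - μ * (1 - (e ⬝ᵥ c) ^ 2)) (hBc : quad B c = lam0) :
    lam (A + θ • (B - A)) = lam0 ∧ topEigSet (A + θ • (B - A)) = {c, -c} ∧
      (∀ e ∈ unitSphere d, e ⬝ᵥ c = 0 → quad (A + θ • (B - A)) e ≤ lam0 - μ) ∧
      ∀ M : EuclideanSpace ℝ (d × d), dirTopEig (A + θ • (B - A)) M = quad M c := by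
  obtain ⟨hgap, hc0⟩ := gapForm_segment hθ0 hθ1 hA hAc hB hBc
  exact ⟨lam_eq_of_gapForm hc hμ.le hgap hc0, topEigSet_eq_pair_of_gapForm hc hμ hgap hc0,
    fun e he hperp => quad_le_of_gapForm_of_perp hgap he hperp,
    fun M => dirTopEig_eq_quad_of_gapForm hc hμ hgap hc0 M⟩

/-! ## 4. The matrix reading: eigenvector + Rayleigh bound on `c^⊥` give the gap form -/

omit [DecidableEq d] [Nonempty d] in
/-- **Eigenvector + Rayleigh gap on `c^⊥` ⇒ gap form.** For a symmetric matrix `M` with `M c = λ₀ c`,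
`c` a unit vector, and `wᵀMw ≤ (λ₀ − μ) wᵀw` for every `w ⊥ c`:
`eᵀMe ≤ λ₀ − μ(1 − (e·c)²)` for every unit `e` (split `e = (e·c)c + w`; the cross terms vanish by
symmetry). [folklore] -/
theorem gapForm_of_eigenvector {M : Matrix d d ℝ} (hM : M.IsSymm) {c : d → ℝ} (hc : c ∈ unitSphere d)
    {lam0 μ : ℝ} (heig : M *ᵥ c = lam0 • c)
    (hperp : ∀ w : d → ℝ, w ⬝ᵥ c = 0 → w ⬝ᵥ M *ᵥ w ≤ (lam0 - μ) * (w ⬝ᵥ w)) :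
    ∀ e ∈ unitSphere d, quad (SharpClass.DirectorForm.flat M) e ≤ lam0 - μ * (1 - (e ⬝ᵥ c) ^ 2) := by
  intro e he
  have hcc : c ⬝ᵥ c = 1 := hc
  have hee : e ⬝ᵥ e = 1 := he
  rw [SharpClass.DirectorForm.quad_flat]
  -- the component of `e` orthogonal to `c`
  set a : ℝ := e ⬝ᵥ c with ha
  set w : d → ℝ := e - a • c with hw
  have hwc : w ⬝ᵥ c = 0 := by
    rw [hw, sub_dotProduct, smul_dotProduct, hcc, smul_eq_mul, mul_one, ← ha, sub_self]
  have hww : w ⬝ᵥ w = 1 - a ^ 2 := by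
    have h1 : w ⬝ᵥ w = ∑ i, (e i - a * c i) ^ 2 := by
      rw [hw, dotProduct]
      exact Finset.sum_congr rfl fun i _ => by simp [Pi.sub_apply, Pi.smul_apply, smul_eq_mul, sq]
    rw [h1, sum_sq_sub_mul_eq, hee, hcc, ← ha]
    ring
  have he_eq : e = w + a • c := by rw [hw, sub_add_cancel]
  -- `cᵀ M w = 0` and `wᵀ M c = 0`
  have hMc_w : w ⬝ᵥ M *ᵥ c = 0 := by
    rw [heig, dotProduct_smul, hwc, smul_zero]
  have hcM : c ᵥ* M = M *ᵥ c := by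
    rw [← Matrix.mulVec_transpose, hM.eq]
  have hc_Mw : c ⬝ᵥ M *ᵥ w = 0 := by
    rw [Matrix.dotProduct_mulVec, hcM, heig, smul_dotProduct, dotProduct_comm, hwc, smul_zero]
  have hc_Mc : c ⬝ᵥ M *ᵥ c = lam0 := by
    rw [heig, dotProduct_smul, hcc, smul_eq_mul, mul_one]
  -- expand
  have hexp : e ⬝ᵥ M *ᵥ e = w ⬝ᵥ M *ᵥ w + a ^ 2 * lam0 := by
    rw [he_eq, Matrix.mulVec_add, Matrix.mulVec_smul, add_dotProduct, dotProduct_add, dotProduct_add,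
      smul_dotProduct, smul_dotProduct, dotProduct_smul, dotProduct_smul, hMc_w, hc_Mw, hc_Mc]
    simp only [smul_eq_mul, mul_zero, add_zero, zero_add]
    ring
  rw [hexp]
  have hb := hperp w hwc
  rw [hww] at hb
  nlinarith

/-- **K-d, matrix statement (F1 PART I ADD1 Lemma 6′ step (1)).** Symmetric `S⁻, S⁺` with a common
unit eigenvector `c`, `S^± c = λ_w c` (so `(S⁺ − S⁻) c = 0`), strict top on both sides in Rayleigh form
(`wᵀS^±w ≤ (λ_w − μ) wᵀw` on `c^⊥`, `μ > 0`). Then along the whole segment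
`S_θ = S⁻ + θ(S⁺ − S⁻)`, `θ ∈ [0,1]` (flattened): `λ(S_θ) = λ_w`, the top eigen-set is `{c, −c}`, the
Rayleigh values on `c^⊥` are `≤ λ_w − μ`, and `μ(S_θ; M) = cᵀMc` for every direction `M`. [folklore] -/
theorem simpleTop_segment_of_eigenvector {Sm Sp : Matrix d d ℝ} (hSm : Sm.IsSymm) (hSp : Sp.IsSymm)
    {c : d → ℝ} (hc : c ∈ unitSphere d) {lamw μ θ : ℝ} (hμ : 0 < μ) (hθ0 : 0 ≤ θ) (hθ1 : θ ≤ 1)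
    (hm : Sm *ᵥ c = lamw • c) (hp : Sp *ᵥ c = lamw • c)
    (hgm : ∀ w : d → ℝ, w ⬝ᵥ c = 0 → w ⬝ᵥ Sm *ᵥ w ≤ (lamw - μ) * (w ⬝ᵥ w))
    (hgp : ∀ w : d → ℝ, w ⬝ᵥ c = 0 → w ⬝ᵥ Sp *ᵥ w ≤ (lamw - μ) * (w ⬝ᵥ w)) :
    lam (SharpClass.DirectorForm.flat Sm + θ • (SharpClass.DirectorForm.flat Sp -
        SharpClass.DirectorForm.flat Sm)) = lamw ∧
      topEigSet (SharpClass.DirectorForm.flat Sm + θ • (SharpClass.DirectorForm.flat Sp -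
        SharpClass.DirectorForm.flat Sm)) = {c, -c} ∧
      (∀ e ∈ unitSphere d, e ⬝ᵥ c = 0 → quad (SharpClass.DirectorForm.flat Sm +
        θ • (SharpClass.DirectorForm.flat Sp - SharpClass.DirectorForm.flat Sm)) e ≤ lamw - μ) ∧
      ∀ M : EuclideanSpace ℝ (d × d), dirTopEig (SharpClass.DirectorForm.flat Sm +
        θ • (SharpClass.DirectorForm.flat Sp - SharpClass.DirectorForm.flat Sm)) M = quad M c := by
  have hcm : quad (SharpClass.DirectorForm.flat Sm) c = lamw := by
    rw [SharpClass.DirectorForm.quad_flat, hm, dotProduct_smul, show c ⬝ᵥ c = 1 from hc, smul_eq_mul,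
      mul_one]
  have hcp : quad (SharpClass.DirectorForm.flat Sp) c = lamw := by
    rw [SharpClass.DirectorForm.quad_flat, hp, dotProduct_smul, show c ⬝ᵥ c = 1 from hc, smul_eq_mul,
      mul_one]
  exact simpleTop_segment hc hμ hθ0 hθ1 (gapForm_of_eigenvector hSm hc hm hgm) hcm
    (gapForm_of_eigenvector hSp hc hp hgp) hcp

end TopEig

end Summit.NavierStokesRegularity.FunctionalMining

end
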